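import Mathlib.MeasureTheory.Function.L2Space
import Mathlib.MeasureTheory.Function.LpSeminorm.Count
import Mathlib.LinearAlgebra.Matrix.NonsingularInverse
import Literature.MathematicalPhysics.KineticTheory.KineticSlabConductance
import HarnessLib

/-!
# The Milne half-space problem and its extrapolation length (`MilneExtrapolationLength`)

Trunk `Literature/MathematicalPhysics/KineticTheory`; definition request
`defn-MilneExtrapolationLength` (route `KineticSlabContacts` of `AtomisticToContinuum/FouriersLaw`,
crux `MilneContactLaw`, planned child `SlabMilneAsymptotics`: `1/Γ(L) = L/c + ρ + o(1)` with `ρ`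
built from the two walls' Milne data). Built ON TOP of `KineticMedium` /
`KineticMedium.IsSlabSolution` (`KineticSlabConductance.lean`): same medium `(μ, v, C, dom, refl)`,
same mild formulation along characteristics, same albedo wall law — with cold walls.

## The notion (informal)

Stationary slab-symmetric linear transport in the HALF-SPACE `y > 0` of the medium `M`:
`v(k) ∂_y W(y, k) = (C W(y, ·))(k)`, and at the wall `y = 0` the incoming trace is the partially
reflected outgoing one, `W(0, k) = (1 - α(k)) W(0, refl k)` for `v(k) > 0`, with NO emission
(wall at zero temperature: the homogeneous problem; `α ≡ 1` is the black wall "no incoming flux"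
of the classical MILNE PROBLEM). The kernel of `C` — the collision invariants — is spanned by
finitely many profiles `e_i` (one-speed transport: `e = 1`; the two-fluid phonon gas: the
temperature and chemical-potential derivatives of the equilibrium; a binary mixture), paired
with conserved weights `w_i` (densities `∫ w_i W dμ`: energy, number, …). Every solution that
behaves diffusively at infinity is asymptotic, as `y → ∞`, to an exact at-most-linearly-growing
solution of the full-space equation, `W(y, k) ≈ Σ_i (y s_i + c_i) e_i(k) + χ(k)` with `χ`
carrying no conserved density and `C χ = v Σ s_i e_i`: the densities are asymptotically AFFINE in
`y`, slope vector `s`, intercept vector `c`, and the intercept is a linear function of the slope,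
`c = Λ s`. The matrix `Λ` (a length) is the EXTRAPOLATION LENGTH: the interior
(Chapman–Enskog, diffusion) profile `y s + c` vanishes at `y = -Λ` behind the wall. One-speed
isotropic scattering, black wall: `Λ = z₀`, `z₀/l = 0.710446` (Cercignani 1988 Ch. VI §4
(4.21)–(4.22): "the slip coefficient is replaced by the so called extrapolation length `z₀`";
the Kramers slip coefficient is the same functional for shear, ibid. (4.11)–(4.15):
`v₃(x) = a x + A₀ + (layer)`, "`A₀ = ζ a` is the macroscopic slip"). Equivalently
(Bardos–Santos–Sentis 1984; Li–Lu–Sun 2017 §5.2) `z₀` is the end state of the BOUNDED half-space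
solution with incoming data `φ = v`, since `y - v + (that solution)` grows linearly with zero
incoming data.

## Contents

* `MilneData ι K` — a `KineticMedium K` EXTENDED by the wall albedo `albedo : K → ℝ`, the
  invariant profiles `inv : ι → K → ℝ` (a basis of `ker C`) and the conserved weights
  `wt : ι → K → ℝ`; one invariant: `inv = M.e`, `wt = M.w` (`KineticMedium.milneData`).
* `MilneData.IsSolution D W` — `W : ℝ → K → ℝ` is a finite-flux mild solution of the homogeneous
  Milne problem: the `[0, ∞)` analogue of `KineticMedium.IsSlabSolution` with `θL = 0` and no
  right wall (slices in `dom`, equation integrated along characteristics for `μ`-a.e. mode,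
  cold albedo wall law, integrable flux integrands and exchange rates).
* `MilneData.affineProfile`, `MilneData.HasAsymptote D W s c`:
  `W(y) - [Σ_i (y s_i + c_i) e_i + χ] → 0` in `L²(μ)` for some `χ ∈ L²(μ)` with `∫ w_i χ dμ = 0`.
* `MilneExtrapolationLength D Λ` (Prop) — `Λ : Matrix ι ι ℝ` IS the extrapolation length of `D`:
  every solution with an affine asymptote of slope `s` has intercept `Λ s`, and every slope is
  realised; `.unique`, the choice-valued `MilneData.extrapolationLength`, `.extrapolationLength_eq`.
* `MilneData.flux D W i y = ∫ v w_i W(y) dμ` (`= M.energyFlux` for `wt i = M.w`) and its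
  constancy in `y` for solutions when `C` conserves `w_i`
  (`IsSolution.flux_eq_flux_zero`); `MilneData.IsTransportMatrix D 𝕃` — the bulk
  (Onsager/Green–Kubo) matrix `𝕃_ij = -∫ v w_i C⁻¹(v e_j) dμ` stated through the cell problem
  `C χ = v Σ_j s_j e_j`; and the requester's bookkeeping (`MilneData.jumpMatrix`): a slab `(0, L)`
  between walls with extrapolation lengths `Λ₀, Λ_L` has invariant-`i₀` conductance
  `Γ = [𝕃 (L + Λ₀ + Λ_L)⁻¹]_{i₀i₀}`, so `1/Γ = L/𝕃_{i₀i₀} + (𝕃(Λ₀ + Λ_L))_{i₀i₀}/𝕃_{i₀i₀}² + O(1/L)`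
  `= L/𝕃_{i₀i₀} + (𝕃 B 𝕃)_{i₀i₀}/𝕃_{i₀i₀}² + O(1/L)` with `B := (Λ₀ + Λ_L) 𝕃⁻¹` the jump matrix per
  unit wall influx.
* `MilneData.twoStreamScattering β` and `twoStreamScattering.milneExtrapolationLength`: the
  worked two-stream instance, `MilneExtrapolationLength _ (β (2 - α)/α)` (all proved).

## Sources

Cercignani, *The Boltzmann Equation and Its Applications* (1988), Ch. VI §4 "Application of the
general method to the Kramers and Milne problems", eqs. (4.1)–(4.22) (asymptotic affine profile,
slip coefficient / extrapolation length as its intercept, `z₀/l = 0.710446`);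
Bensoussan–Lions–Papanicolaou, Publ. RIMS 15 (1979) §1.5 "Half-space problems" ((1.5.3): the
bounded half-space solution has a constant limit at infinity, approached exponentially fast),
§3.5–3.6 (boundary layers at absorbing / reflecting walls); Li–Lu–Sun (2017; arXiv:1408.6630)
§2.1 ((A1)–(A4): `ker 𝓛` finite-dimensional, `P₁ = P(v ·)|_{ker}` and its eigenspaces `H^±, H⁰`),
§2.3 (half-space problem with end state `f_∞ ∈ H⁺ ⊕ H⁰`; Thm 2.1 = Coron–Golse–Sulem 1988), §5.2
(the end state for data `φ = v` is the extrapolation length); Bardos–Santos–Sentis, Trans. AMS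
284 (1984) (Milne problem, extrapolation length in the diffusion approximation; not held,
acq-02595); Aoki–Lin–Wu, JDE 269 (2020) (binary mixture: several invariants); for the medium and
the wall law, the sources of `KineticSlabConductance.lean` (Komorowski–Olla 2020).

## Design choices

* REUSE: `MilneData extends KineticMedium`, and `IsSolution` copies the clauses of
  `KineticMedium.IsSlabSolution` on `[0, ∞)` with `θL = 0` (cold wall) and no right wall, so that
  restrictions / comparisons between slab and half-space solutions are literal.
* FUNCTION LEVEL and MILD FORM exactly as there: `C` is a bare map with a domain `dom`, the
  equation is integrated along characteristics for `μ`-a.e. mode and every `y ≥ 0` (honest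
  traces at the wall), pairings are Bochner integrals.
* No growth condition in `IsSolution`: the behaviour at infinity is carried by `HasAsymptote`
  (plain `L²(μ)` convergence to the affine profile, the space of Coron–Golse–Sulem / Li–Lu–Sun; no
  rate is built in — the sources prove an exponential one for gapped one-speed operators), and
  `MilneExtrapolationLength` only looks at solutions having an asymptote: exponentially growing
  half-range modes have none, the diffusion pair is kept (Case–Zweifel's Milne problem).
* The invariants are DATA (`inv`, with their conserved weights `wt`), because the requester wants
  matrix entries in a physical basis (`(𝕃Λ)_ee`, energy index); `χ` "carries no density"
  (`∫ w_i χ = 0`) makes `(s, c)` unique once the susceptibility matrix `∫ w_i e_j dμ` is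
  invertible. `Λ` is PER UNIT SLOPE (a length, `0.7104…`); the flux-normalised jump matrix is the
  derived `Λ 𝕃⁻¹`.
* `MilneExtrapolationLength D Λ` is a uniqueness-and-existence predicate: `Λ` is unique when it
  exists (`.unique`); on degenerate problems (perfect mirror `α = 0`: constants solve the problem
  with slope `0`, infinite extrapolation length) it is false for every `Λ`. Well-posedness
  (existence of `Λ`) is a theorem of the sources for gapped one-speed operators and black/grey
  walls, NOT asserted here. NON-VACUITY and a check of signs/normalisations: the worked
  two-stream instance at the end (`MilneData.twoStreamScattering.milneExtrapolationLength`: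
  velocities `±β`, isotropic scattering, constant albedo `α` — every mild solution is affine and
  `Λ = β (2 - α)/α`, the black-wall two-stream value `β` times the grey-wall factor `(2 - α)/α`).
* Not here: emission / warm walls (superpose `KineticMedium.IsSlabSolution`-type data by
  linearity), rates, the value `0.710446`, the phonon collision operator.
-/

noncomputable section

open MeasureTheory Filter Set
open scoped ENNReal Topology Matrix

namespace Literature.MathematicalPhysics.KineticTheory

/-- Data of a homogeneous (cold-wall) MILNE HALF-SPACE PROBLEM: a kinetic medium
`(μ, v, C, dom, refl, e, w)` (`KineticMedium`, as in `KineticSlabConductance`) together with the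
albedo `albedo : K → [0, 1]` of the wall at `y = 0` (absorption probability; `1` = black wall of
the classical Milne problem, `0` = perfect mirror), a finite family `inv i` of collision-invariant
profiles spanning `ker C` (equilibrium perturbations; one-speed transport: `inv = e = 1`) and the
conserved weights `wt i` whose moments `∫ wt_i W dμ` are the densities (one invariant: `wt = w`).
Setting of Li–Lu–Sun 2017 §2.1, §2.3 (`u = 0`, finite-dimensional kernel) on the medium and wall
law of Komorowski–Olla (see `KineticMedium`). [cite: LiLuSun2017, §2.1 and §2.3] -/
structure MilneData (ι K : Type*) [MeasurableSpace K] extends KineticMedium K where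
  /-- absorption probability of the wall at `y = 0` (emissivity = absorptivity) -/
  albedo : K → ℝ
  /-- collision-invariant profiles: a chosen basis of `ker C` -/
  inv : ι → K → ℝ
  /-- conserved weights: `∫ wt i · W dμ` is the `i`-th conserved density of the profile `W` -/
  wt : ι → K → ℝ

/-- The one-invariant Milne data of a kinetic medium with wall albedo `α`: invariant profile
`e`, conserved weight `w` (energy). [folklore] -/
def KineticMedium.milneData {K : Type*} [MeasurableSpace K] (M : KineticMedium K) (α : K → ℝ) :
    MilneData Unit K where
  toKineticMedium := M
  albedo := α
  inv := fun _ => M.e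
  wt := fun _ => M.w

namespace MilneData

variable {ι K : Type*} [MeasurableSpace K] (D : MilneData ι K)

/-! ### Mild solutions of the homogeneous Milne problem -/

/-- `D.IsSolution W`: `W : ℝ → K → ℝ` (height `y ≥ 0`, mode `k`) is a **finite-flux mild
solution of the homogeneous Milne half-space problem** of `D` — slices `W(y,·) ∈ dom` for
`y ≥ 0`; for `μ`-a.e. mode `k` the collision term is locally integrable along the characteristic
and `v(k) (W(y,k) - W(0,k)) = ∫₀ʸ (C W(s,·))(k) ds` for every `y ≥ 0` (the stationary equation
`v ∂_y W = C W`; for `v(k) = 0` the constraint `C W(·,k) = 0` a.e.); the COLD albedo wall law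
`W(0,k) = (1 - α(k)) W(0, refl k)` for `μ`-a.e. incoming mode (`v(k) > 0`): absorption with
probability `α`, specular reflection otherwise, no emission (for the black wall `α ≡ 1` the
Milne condition "no incoming flux", Cercignani 1988 Ch. VI (4.4)); the flux integrands
`v wt_i W(y,·)` are integrable and the exchange rates `wt_i · C W` are integrable on every
`[0, Y] × K`. Literally `KineticMedium.IsSlabSolution` with `θL = 0` on `[0, ∞)` and no right wall.
[cite: Cercignani1988, Ch. VI §4 (4.1)–(4.6)] -/
structure IsSolution (W : ℝ → K → ℝ) : Prop where
  /-- every slice lies in the domain of the collision operator -/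
  mem_dom : ∀ y : ℝ, 0 ≤ y → W y ∈ D.dom
  /-- for a.e. mode the collision term is locally integrable along the characteristic -/
  collision_integrableOn : ∀ᵐ k ∂D.μ, ∀ Y : ℝ, 0 ≤ Y → IntegrableOn (fun y => D.C (W y) k) (Icc 0 Y)
  /-- the transport equation `v ∂_y W = C W` on `(0, ∞)`, mild form, for a.e. mode -/
  transport : ∀ᵐ k ∂D.μ, ∀ y : ℝ, 0 ≤ y → D.v k * (W y k - W 0 k) = ∫ s in (0 : ℝ)..y, D.C (W s) k
  /-- cold albedo wall at `y = 0`: incoming = partially reflected outgoing, no emission -/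
  wall : ∀ᵐ k ∂D.μ, 0 < D.v k → W 0 k = (1 - D.albedo k) * W 0 (D.refl k)
  /-- the flux integrands are integrable at every height -/
  flux_integrable : ∀ i, ∀ y : ℝ, 0 ≤ y → Integrable (fun k => D.v k * D.wt i k * W y k) D.μ
  /-- the exchange rates `wt_i · C W` are integrable on `[0, Y] × K` -/
  exchange_integrable : ∀ i, ∀ Y : ℝ, 0 ≤ Y →
    Integrable (fun p : ℝ × K => D.wt i p.2 * D.C (W p.1) p.2) ((volume.restrict (Icc 0 Y)).prod D.μ)

/-! ### Affine (diffusion) asymptotes -/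

section Asymptote

variable [Fintype ι]

/-- The collision-invariant ("fluid") profile with coefficient vector `a`: `Σ_i a_i e_i`.
[folklore] -/
def fluid (a : ι → ℝ) : K → ℝ :=
  fun k => ∑ i, a i * D.inv i k

/-- Unfolding of `fluid`. [folklore] -/
@[simp]
theorem fluid_apply (a : ι → ℝ) (k : K) : D.fluid a k = ∑ i, a i * D.inv i k :=
  rfl

/-- The AFFINE (Chapman–Enskog / diffusion) PROFILE with slope vector `s`, intercept vector `c`
and kinetic correction `χ`: `(y, k) ↦ Σ_i (y s_i + c_i) e_i(k) + χ(k)`. For `χ = C⁻¹(v Σ s_i e_i)`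
these are the exact at-most-linearly-growing solutions of the full-space equation (one-speed
case `A₀ + A₁ (x - ξ)`, Cercignani 1988 Ch. VI (5.1); `a x + A₀ + …`, ibid. (4.11), (4.15)).
[cite: Cercignani1988, Ch. VI §4 (4.11), (4.15) and §5 (5.1)] -/
def affineProfile (s c : ι → ℝ) (χ : K → ℝ) (y : ℝ) : K → ℝ :=
  fun k => (∑ i, (y * s i + c i) * D.inv i k) + χ k

/-- Unfolding of `affineProfile`. [folklore] -/
@[simp]
theorem affineProfile_apply (s c : ι → ℝ) (χ : K → ℝ) (y : ℝ) (k : K) :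
    D.affineProfile s c χ y k = (∑ i, (y * s i + c i) * D.inv i k) + χ k :=
  rfl

/-- `D.HasAsymptote W s c`: as `y → ∞` the phase density `W` is asymptotic in `L²(μ)` to the
affine profile of slope `s` and intercept `c` plus a `y`-independent kinetic part `χ ∈ L²(μ)`
carrying NO conserved density (`∫ wt_i χ dμ = 0`):
`‖W y - (Σ_i (y s_i + c_i) e_i + χ)‖_{L²(μ)} → 0`. Hence the densities `∫ wt_i W(y) dμ` are
asymptotically `Σ_j (∫ wt_i e_j dμ)(y s_j + c_j)`: affine with slope `s` and intercept `c` —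
Cercignani's `v₃(x) = a x + A₀ + (decaying)` (4.11), BLP's constant limit at infinity of the
bounded problem (1.5.3), Li–Lu–Sun's end state `f - f_∞ → 0` (§2.3).
[cite: Cercignani1988, Ch. VI §4 (4.11)] -/
def HasAsymptote (W : ℝ → K → ℝ) (s c : ι → ℝ) : Prop :=
  ∃ χ : K → ℝ, MemLp χ 2 D.μ ∧ (∀ i, ∫ k, D.wt i k * χ k ∂D.μ = 0) ∧
    Tendsto (fun y : ℝ => eLpNorm (W y - D.affineProfile s c χ y) 2 D.μ) atTop (𝓝 0)

end Asymptote

end MilneData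

section ExtrapolationLength

variable {ι K : Type*} [MeasurableSpace K] [Fintype ι]

/-- `MilneExtrapolationLength D Λ`: **the matrix `Λ` is the (Milne) EXTRAPOLATION LENGTH of the
half-space problem `D`** — (i) every mild solution of the homogeneous Milne problem
(`D.IsSolution`) having an affine asymptote with slope `s` and intercept `c` (`D.HasAsymptote`)
satisfies `c = Λ s`, and (ii) every slope `s` is realised by such a solution (with intercept
`Λ s`). So the interior affine density profile `y s + Λ s` of the solution driven by the gradient
`s` extrapolates to zero at distance `Λ` behind the wall. One invariant, one-speed isotropic
scattering, black wall: `Λ = z₀`, `z₀/l = 0.710446` (Cercignani 1988 (4.21)–(4.22); the Kramers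
slip coefficient `ζ`, (4.13)–(4.15), is the same functional for shear); equivalently `z₀` is the
end state of the bounded half-space solution with incoming data `φ = v` (Li–Lu–Sun 2017 §5.2;
Bardos–Santos–Sentis 1984). Several invariants (binary mixtures, Aoki–Lin–Wu 2020; the two-fluid
phonon gas of the requester) make `Λ` a `dim ker C × dim ker C` matrix in the basis `inv`. False
for every `Λ` on degenerate problems (perfect mirror).
[cite: Cercignani1988, Ch. VI §4 (4.13)–(4.15) and (4.21)–(4.22)] -/
structure MilneExtrapolationLength (D : MilneData ι K) (Λ : Matrix ι ι ℝ) : Prop where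
  /-- the intercept of every solution is `Λ` times its slope -/
  intercept_eq : ∀ ⦃W : ℝ → K → ℝ⦄ ⦃s c : ι → ℝ⦄,
    D.IsSolution W → D.HasAsymptote W s c → c = Λ *ᵥ s
  /-- every slope is realised by a solution of the Milne problem -/
  exists_isSolution : ∀ s : ι → ℝ, ∃ W : ℝ → K → ℝ, D.IsSolution W ∧ D.HasAsymptote W s (Λ *ᵥ s)

namespace MilneExtrapolationLength

variable {D : MilneData ι K} {Λ Λ' : Matrix ι ι ℝ}

/-- The extrapolation length is unique: two matrices satisfying `MilneExtrapolationLength D`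
coincide (existence for `Λ`, the intercept law for `Λ'`, tested on coordinate slopes).
[folklore] -/
theorem unique (h : MilneExtrapolationLength D Λ) (h' : MilneExtrapolationLength D Λ') :
    Λ = Λ' := by
  classical
  have hcol : ∀ s : ι → ℝ, Λ *ᵥ s = Λ' *ᵥ s := by
    intro s
    obtain ⟨W, hW, hA⟩ := h.exists_isSolution s
    exact h'.intercept_eq hW hA
  ext i j
  have := congrFun (hcol (Pi.single j 1)) i
  rwa [Matrix.mulVec_single_one, Matrix.mulVec_single_one, Matrix.col_apply,
    Matrix.col_apply] at this

end MilneExtrapolationLength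

namespace MilneData

variable (D : MilneData ι K)

/-- THE extrapolation length of `D` as a matrix: the unique `Λ` with
`MilneExtrapolationLength D Λ` when one exists (by choice; `MilneExtrapolationLength.unique`),
the junk value `0` otherwise (degenerate problems). [folklore] -/
def extrapolationLength : Matrix ι ι ℝ := by
  classical
  exact if h : ∃ Λ, MilneExtrapolationLength D Λ then h.choose else 0

/-- When some extrapolation length exists, `D.extrapolationLength` is one. [folklore] -/
theorem milneExtrapolationLength_extrapolationLength (h : ∃ Λ, MilneExtrapolationLength D Λ) :
    MilneExtrapolationLength D D.extrapolationLength := by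
  classical
  unfold extrapolationLength
  rw [dif_pos h]
  exact h.choose_spec

variable {D} in
/-- Any extrapolation length of `D` is `D.extrapolationLength`. [folklore] -/
theorem _root_.Literature.MathematicalPhysics.KineticTheory.MilneExtrapolationLength.extrapolationLength_eq
    {Λ : Matrix ι ι ℝ} (h : MilneExtrapolationLength D Λ) : D.extrapolationLength = Λ :=
  (D.milneExtrapolationLength_extrapolationLength ⟨Λ, h⟩).unique h

/-- Without well-posedness, the junk value: `D.extrapolationLength = 0` when no matrix is an
extrapolation length of `D`. [folklore] -/
theorem extrapolationLength_of_not_exists (h : ¬ ∃ Λ, MilneExtrapolationLength D Λ) :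
    D.extrapolationLength = 0 := by
  classical
  unfold extrapolationLength
  rw [dif_neg h]

end MilneData

end ExtrapolationLength

namespace MilneData

variable {ι K : Type*} [MeasurableSpace K] (D : MilneData ι K)

/-! ### Fluxes and their constancy -/

/-- The flux of the conserved quantity `i` through the plane `{y}` carried by `W`:
`J_i(y) = ∫ v wt_i W(y) dμ` (`= KineticMedium.energyFlux` when `wt i = w`). [folklore] -/
def flux (W : ℝ → K → ℝ) (i : ι) (y : ℝ) : ℝ :=
  ∫ k, D.v k * D.wt i k * W y k ∂D.μ

/-- For the one-invariant data of a medium, `flux` is the medium's energy flux. [folklore] -/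
theorem _root_.Literature.MathematicalPhysics.KineticTheory.KineticMedium.milneData_flux
    (M : KineticMedium K) (α : K → ℝ) (W : ℝ → K → ℝ) (u : Unit) (y : ℝ) :
    (M.milneData α).flux W u y = M.energyFlux W y :=
  rfl

variable {D} in
/-- **Constancy of the fluxes.** If `W` is a finite-flux mild solution of the Milne problem and
`C` conserves the quantity `i` on its slices (`∫ wt_i · C W(s,·) dμ = 0`, `s ≥ 0`), then
`J_i(y) = J_i(0)` for every `y ≥ 0`: `J(y) - J(0) = ∫ wt v (W(y) - W(0)) = ∫ wt ∫₀ʸ C W =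
∫₀ʸ ∫ wt C W = 0` (Fubini) — the proof of `IsSlabSolution.energyFlux_eq_energyFlux_zero`.
[folklore] -/
theorem IsSolution.flux_eq_flux_zero [SFinite D.μ] {W : ℝ → K → ℝ} (h : D.IsSolution W) (i : ι)
    (hcons : ∀ s : ℝ, 0 ≤ s → ∫ k, D.wt i k * D.C (W s) k ∂D.μ = 0) {y : ℝ} (hy : 0 ≤ y) :
    D.flux W i y = D.flux W i 0 := by
  have hdiff : D.flux W i y - D.flux W i 0 =
      ∫ k, D.wt i k * (D.v k * (W y k - W 0 k)) ∂D.μ := by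
    unfold flux
    rw [← integral_sub (h.flux_integrable i y hy) (h.flux_integrable i 0 le_rfl)]
    congr 1
    ext k
    ring
  have h2 : ∫ k, D.wt i k * (D.v k * (W y k - W 0 k)) ∂D.μ =
      ∫ k, D.wt i k * (∫ s in Ioc 0 y, D.C (W s) k) ∂D.μ := by
    apply integral_congr_ae
    filter_upwards [h.transport] with k hk
    rw [hk y hy, intervalIntegral.integral_of_le hy]
  have hint : Integrable (fun p : ℝ × K => D.wt i p.2 * D.C (W p.1) p.2)
      ((volume.restrict (Ioc 0 y)).prod D.μ) :=
    (h.exchange_integrable i y hy).mono_measure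
      (Measure.prod_mono (Measure.restrict_mono Ioc_subset_Icc_self le_rfl) le_rfl)
  have h3 : ∫ k, D.wt i k * (∫ s in Ioc 0 y, D.C (W s) k) ∂D.μ =
      ∫ s in Ioc 0 y, ∫ k, D.wt i k * D.C (W s) k ∂D.μ := by
    rw [integral_integral_swap (f := fun s k => D.wt i k * D.C (W s) k) hint]
    congr 1
    ext k
    rw [← integral_const_mul]
  have h4 : ∫ s in Ioc 0 y, ∫ k, D.wt i k * D.C (W s) k ∂D.μ = 0 :=
    setIntegral_eq_zero_of_forall_eq_zero fun s hs => hcons s hs.1.le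
  have : D.flux W i y - D.flux W i 0 = 0 := by rw [hdiff, h2, h3, h4]
  linarith

/-! ### The bulk transport matrix and the slab bookkeeping -/

section Transport

variable [Fintype ι]

/-- `D.IsTransportMatrix 𝕃`: **`𝕃` is the bulk transport (Onsager, Green–Kubo) matrix** of the
medium in the basis `inv` / weights `wt`, `𝕃_ij = -∫ v wt_i C⁻¹(v e_j) dμ`, stated without
inverting `C` through the CELL PROBLEM: whenever `χ ∈ dom ∩ L²(μ)` carries no density and solves
`C χ = v · Σ_j s_j e_j`, the influx it carries is `-∫ v wt_i χ dμ = (𝕃 s)_i`, and every slope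
`s` has such a `χ`. For the exact affine solution `Σ (y s_i + c_i) e_i + χ` this is
Fick/Fourier's law "flux towards the wall `= 𝕃 ·` gradient" (Cercignani 1988 Ch. VI (4.2): the
Hilbert particular solution `L⁻¹(2 a c₁ c₃)` of the Kramers problem).
[cite: Cercignani1988, Ch. VI §4 (4.2)] -/
structure IsTransportMatrix (𝕃 : Matrix ι ι ℝ) : Prop where
  /-- the influx carried by a solution of the cell problem with slope `s` is `𝕃 s` -/
  influx_eq : ∀ ⦃s : ι → ℝ⦄ ⦃χ : K → ℝ⦄, χ ∈ D.dom → MemLp χ 2 D.μ →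
    (∀ i, ∫ k, D.wt i k * χ k ∂D.μ = 0) → D.C χ = (fun k => D.v k * D.fluid s k) →
    ∀ i, -(∫ k, D.v k * D.wt i k * χ k ∂D.μ) = (𝕃 *ᵥ s) i
  /-- the cell problem is solvable for every slope -/
  exists_cell : ∀ s : ι → ℝ, ∃ χ : K → ℝ, χ ∈ D.dom ∧ MemLp χ 2 D.μ ∧
    (∀ i, ∫ k, D.wt i k * χ k ∂D.μ = 0) ∧ D.C χ = fun k => D.v k * D.fluid s k

variable {D} in
/-- The transport matrix is unique. [folklore] -/
theorem IsTransportMatrix.unique {𝕃 𝕃' : Matrix ι ι ℝ} (h : D.IsTransportMatrix 𝕃)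
    (h' : D.IsTransportMatrix 𝕃') : 𝕃 = 𝕃' := by
  classical
  have hcol : ∀ s : ι → ℝ, 𝕃 *ᵥ s = 𝕃' *ᵥ s := by
    intro s
    obtain ⟨χ, hdom, hχ, horth, hcell⟩ := h.exists_cell s
    funext i
    rw [← h.influx_eq hdom hχ horth hcell i, ← h'.influx_eq hdom hχ horth hcell i]
  ext i j
  have := congrFun (hcol (Pi.single j 1)) i
  rwa [Matrix.mulVec_single_one, Matrix.mulVec_single_one, Matrix.col_apply,
    Matrix.col_apply] at this

/-- The JUMP MATRIX PER UNIT WALL INFLUX, `B = Λ 𝕃⁻¹`: intercept `c = Λ s = B (𝕃 s)` =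
`B ·` (influx). With the two walls' `B₀, B_L` of a slab `(0, L)` the invariant-`i₀` resistance
is `1/Γ = L/𝕃_{i₀i₀} + (𝕃 (B₀ + B_L) 𝕃)_{i₀i₀}/𝕃_{i₀i₀}² + O(1/L)` (bulk plus two contact
resistances in series — the requester's `ρ = (𝕃B𝕃)_ee/𝕃_ee²`); one invariant: `B = z₀/𝕃`.
[folklore] -/
def jumpMatrix [DecidableEq ι] (Λ 𝕃 : Matrix ι ι ℝ) : Matrix ι ι ℝ :=
  Λ * 𝕃⁻¹

/-- `jumpMatrix Λ 𝕃` converts influx back to intercept: `B (𝕃 s) = Λ s` when `𝕃` is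
invertible. [folklore] -/
theorem jumpMatrix_mulVec_mulVec [DecidableEq ι] (Λ 𝕃 : Matrix ι ι ℝ) (h𝕃 : IsUnit 𝕃.det)
    (s : ι → ℝ) : jumpMatrix Λ 𝕃 *ᵥ (𝕃 *ᵥ s) = Λ *ᵥ s := by
  rw [jumpMatrix, Matrix.mulVec_mulVec, Matrix.mul_assoc, Matrix.nonsing_inv_mul _ h𝕃,
    Matrix.mul_one]

end Transport

end MilneData

/-! ### Worked instance: the two-stream (Schuster–Schwarzschild) Milne problem

Velocities `±β`, isotropic scattering `C f = ⟨f⟩ - f` (relaxation to the mean of the two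
streams), one invariant `e = w = 1`, grey wall of constant albedo `α`. Every mild solution is
AFFINE in `y` (the model has no half-range transients), the cold wall law fixes the intercept,
and `Λ = β (2 - α)/α`: `β` for the black wall (`β = 1/√3` is the two-stream / Eddington value
`0.577` of the extrapolation length, against the exact `0.7104`), enlarged by the grey-wall
factor `(2 - α)/α`. This checks signs and normalisations and shows the notion is not vacuous. -/

namespace MilneData

/-- The **two-stream scattering medium** on `K = Bool` (`true` = movers away from the wall):
counting measure, `v = ±β`, isotropic scattering `C f = (f(→) + f(←))/2 - f` on all profiles,
reflection `not`, `e = w = 1` (the collisional companion of `twoStreamMedium`). [folklore] -/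
def twoStreamScattering (β : ℝ) : KineticMedium Bool where
  μ := Measure.dirac true + Measure.dirac false
  v := fun b => bif b then β else -β
  C := fun f b => (f true + f false) / 2 - f b
  dom := Set.univ
  refl := fun b => !b
  e := fun _ => 1
  w := fun _ => 1

namespace twoStreamScattering

/-- Convergence in `L²` of the two-point space is convergence of both values. [folklore] -/
theorem tendsto_apply_of_tendsto_eLpNorm {G : ℝ → Bool → ℝ}
    (h : Tendsto (fun y => eLpNorm (G y) 2 (Measure.dirac true + Measure.dirac false)) atTop
      (𝓝 0)) (b : Bool) : Tendsto (fun y => G y b) atTop (𝓝 0) := by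
  rw [tendsto_zero_iff_enorm_tendsto_zero]
  refine tendsto_of_tendsto_of_tendsto_of_le_of_le tendsto_const_nhds h (fun _ => zero_le) ?_
  intro y
  dsimp only
  rw [← eLpNorm_dirac (G y) b two_ne_zero]
  apply eLpNorm_mono_measure
  cases b
  · exact Measure.le_add_left le_rfl
  · exact Measure.le_add_right le_rfl

/-- An affine function with a finite limit at `+∞` is constant (and equal to the limit).
[folklore] -/
theorem eq_zero_of_tendsto_affine {a b : ℝ} (h : Tendsto (fun y : ℝ => a * y + b) atTop (𝓝 0)) :
    a = 0 ∧ b = 0 := by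
  have h1 : Tendsto (fun y : ℝ => a * (y + 1) + b) atTop (𝓝 0) :=
    h.comp (tendsto_atTop_add_const_right atTop 1 tendsto_id)
  have ha : Tendsto (fun y : ℝ => (a * (y + 1) + b) - (a * y + b)) atTop (𝓝 (0 - 0)) := h1.sub h
  have ha' : (fun y : ℝ => (a * (y + 1) + b) - (a * y + b)) = fun _ => a := by
    funext y
    ring
  rw [ha', sub_zero] at ha
  have haz : a = 0 := tendsto_nhds_unique tendsto_const_nhds ha
  subst haz
  simp only [zero_mul, zero_add] at h
  exact ⟨rfl, tendsto_nhds_unique tendsto_const_nhds h⟩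

/-- **The two-stream Milne problem.** For stream speed `β > 0` and a wall of constant albedo
`α ≠ 0`, the extrapolation length of the two-stream scattering medium is `β (2 - α)/α`:
EVERY mild solution with an affine asymptote of slope `s` has intercept `β (2 - α)/α · s`, and
the affine profile `W(y, →) = p + s y`, `W(y, ←) = p + 2βs + s y`, `p = 2βs(1 - α)/α` realises the
slope `s` (black wall `α = 1`: `Λ = β`, the two-stream value of the Milne extrapolation length;
the grey-wall enlargement factor is `(2 - α)/α`). [folklore] -/
theorem milneExtrapolationLength {β α : ℝ} (hβ : 0 < β) (hα : α ≠ 0) :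
    MilneExtrapolationLength ((twoStreamScattering β).milneData fun _ => α)
      (Matrix.of fun _ _ => β * (2 - α) / α) where
  intercept_eq := by
    intro W s c hW hA
    obtain ⟨χ, -, horth, hlim⟩ := hA
    have htr := hW.transport
    have hwall := hW.wall
    simp only [KineticMedium.milneData, twoStreamScattering, ae_add_measure_iff, ae_dirac_eq,
      Filter.eventually_pure] at htr hwall horth hlim
    obtain ⟨htr1, htr2⟩ := htr
    have hw : W 0 true = (1 - α) * W 0 false := by
      have := hwall.1 hβ
      simpa using this
    -- no density in `χ`
    have hχ : χ true + χ false = 0 := by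
      have := horth ()
      rw [integral_add_measure Integrable.of_finite Integrable.of_finite, integral_dirac,
        integral_dirac] at this
      simpa using this
    -- the difference of the two streams is constant
    have hneg : ∀ y : ℝ, ∫ s in (0 : ℝ)..y, ((W s true + W s false) / 2 - W s false) =
        -∫ s in (0 : ℝ)..y, ((W s true + W s false) / 2 - W s true) := by
      intro y
      rw [← intervalIntegral.integral_neg]
      congr 1
      funext s
      ring
    have hd : ∀ y : ℝ, 0 ≤ y → W y false = W y true - (W 0 true - W 0 false) := by
      intro y hy
      have e1 := htr1 y hy
      have e2 := htr2 y hy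
      simp only [cond_true, cond_false] at e1 e2
      rw [hneg] at e2
      have : β * (W y true - W 0 true) = β * (W y false - W 0 false) := by linarith
      have := mul_left_cancel₀ hβ.ne' this
      linarith
    -- hence the streams are affine
    have hWt : ∀ y : ℝ, 0 ≤ y →
        W y true = -(W 0 true - W 0 false) / (2 * β) * y + W 0 true := by
      intro y hy
      have e1 := htr1 y hy
      simp only [cond_true] at e1
      have hI : ∫ s in (0 : ℝ)..y, ((W s true + W s false) / 2 - W s true) =
          ∫ _ in (0 : ℝ)..y, (-(W 0 true - W 0 false) / 2) := by
        apply intervalIntegral.integral_congr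
        intro s hs
        rw [uIcc_of_le hy] at hs
        have := hd s hs.1
        dsimp only
        linarith
      rw [hI, intervalIntegral.integral_const, smul_eq_mul] at e1
      field_simp
      linarith
    -- read off slope and intercepts from the asymptote, stream by stream
    have hlt := tendsto_apply_of_tendsto_eLpNorm hlim true
    have hlf := tendsto_apply_of_tendsto_eLpNorm hlim false
    have hlt' : Tendsto (fun y : ℝ => (-(W 0 true - W 0 false) / (2 * β) - s ()) * y +
        (W 0 true - c () - χ true)) atTop (𝓝 0) := by
      refine hlt.congr' ?_
      filter_upwards [eventually_ge_atTop 0] with y hy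
      simp only [Pi.sub_apply, affineProfile_apply, Fintype.sum_unique, mul_one]
      rw [hWt y hy]
      ring
    have hlf' : Tendsto (fun y : ℝ => (-(W 0 true - W 0 false) / (2 * β) - s ()) * y +
        (W 0 true - (W 0 true - W 0 false) - c () - χ false)) atTop (𝓝 0) := by
      refine hlf.congr' ?_
      filter_upwards [eventually_ge_atTop 0] with y hy
      simp only [Pi.sub_apply, affineProfile_apply, Fintype.sum_unique, mul_one]
      rw [hd y hy, hWt y hy]
      ring
    obtain ⟨ha, hbt⟩ := eq_zero_of_tendsto_affine hlt'
    obtain ⟨-, hbf⟩ := eq_zero_of_tendsto_affine hlf'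
    -- algebra
    have hslope : W 0 false = W 0 true + 2 * β * s () := by
      field_simp at ha
      linarith
    funext u
    cases u
    simp only [Matrix.mulVec, Matrix.of_apply, dotProduct, Fintype.sum_unique]
    rw [div_mul_eq_mul_div, eq_div_iff hα]
    rw [hslope] at hw hbf
    linear_combination (-(α / 2)) * hbt + (-(α / 2)) * hbf + (-(α / 2)) * hχ + hw
  exists_isSolution := by
    intro s
    refine ⟨fun y b => bif b then 2 * β * s () * (1 - α) / α + s () * y
      else 2 * β * s () * (1 - α) / α + 2 * β * s () + s () * y, ?_, ?_⟩
    · refine ⟨fun _ _ => Set.mem_univ _, ?_, ?_, ?_, ?_, ?_⟩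
      · refine Eventually.of_forall fun k Y _ => ?_
        refine (continuous_const (y := bif k then β * s () else -(β * s ()))).integrableOn_Icc.congr_fun
          (fun y _ => ?_) measurableSet_Icc
        cases k <;> simp [twoStreamScattering, KineticMedium.milneData] <;> ring
      · refine Eventually.of_forall fun k y _ => ?_
        have hI : ∀ cst : ℝ, ∫ _ in (0 : ℝ)..y, cst = cst * y := by
          intro cst
          rw [intervalIntegral.integral_const, smul_eq_mul]
          ring
        cases k
        · simp only [KineticMedium.milneData, twoStreamScattering, cond_false, cond_true]
          rw [intervalIntegral.integral_congr (g := fun _ => -(β * s ())) (fun x _ => by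
            dsimp only; ring), hI]
          ring
        · simp only [KineticMedium.milneData, twoStreamScattering, cond_true, cond_false]
          rw [intervalIntegral.integral_congr (g := fun _ => β * s ()) (fun x _ => by
            dsimp only; ring), hI]
          ring
      · simp only [KineticMedium.milneData, twoStreamScattering, ae_add_measure_iff, ae_dirac_eq,
          Filter.eventually_pure]
        refine ⟨fun _ => ?_, fun h => ?_⟩
        · simp only [cond_true, Bool.not_true, cond_false, mul_zero, add_zero]
          field_simp
          ring
        · simp at h
          linarith
      · intro i y _
        show Integrable _ (Measure.dirac true + Measure.dirac false)
        exact Integrable.of_finite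
      · intro i Y _
        show Integrable _ ((volume.restrict (Icc (0 : ℝ) Y)).prod
          (Measure.dirac true + Measure.dirac false))
        haveI : IsFiniteMeasure (volume.restrict (Icc (0 : ℝ) Y)) :=
          isFiniteMeasure_restrict.2 measure_Icc_lt_top.ne
        have hg : Integrable (fun z : ℝ × Bool => (1 : ℝ) * (bif z.2 then β * s () else -(β * s ())))
            ((volume.restrict (Icc (0 : ℝ) Y)).prod (Measure.dirac true + Measure.dirac false)) :=
          (integrable_const (1 : ℝ)).mul_prod
            (g := fun b : Bool => bif b then β * s () else -(β * s ())) Integrable.of_finite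
        refine hg.congr (Eventually.of_forall fun z => ?_)
        obtain ⟨y, b⟩ := z
        cases b <;> simp [twoStreamScattering, KineticMedium.milneData] <;> ring
    · refine ⟨fun b => bif b then -(β * s ()) else β * s (), ?_, fun _ => ?_, ?_⟩
      · show MemLp _ 2 (Measure.dirac true + Measure.dirac false)
        exact MemLp.of_discrete
      · simp only [KineticMedium.milneData, twoStreamScattering]
        rw [integral_add_measure Integrable.of_finite Integrable.of_finite, integral_dirac,
          integral_dirac]
        simp
      · have hzero : ∀ y : ℝ, ((fun b => bif b then 2 * β * s () * (1 - α) / α + s () * y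
            else 2 * β * s () * (1 - α) / α + 2 * β * s () + s () * y) -
            ((twoStreamScattering β).milneData fun _ => α).affineProfile s
              ((Matrix.of fun _ _ => β * (2 - α) / α) *ᵥ s)
              (fun b => bif b then -(β * s ()) else β * s ()) y) = 0 := by
          intro y
          funext b
          cases b <;>
            simp [affineProfile, KineticMedium.milneData, twoStreamScattering, Matrix.mulVec,
              dotProduct] <;> field_simp <;> ring
        simp only [hzero, eLpNorm_zero]
        exact tendsto_const_nhds

/-- Hence the extrapolation length OF the two-stream medium, as a number (`1 × 1` matrix), is
`β (2 - α)/α`. [folklore] -/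
theorem extrapolationLength_eq {β α : ℝ} (hβ : 0 < β) (hα : α ≠ 0) :
    ((twoStreamScattering β).milneData fun _ => α).extrapolationLength =
      Matrix.of fun _ _ => β * (2 - α) / α :=
  (milneExtrapolationLength hβ hα).extrapolationLength_eq

end twoStreamScattering

end MilneData

end Literature.MathematicalPhysics.KineticTheory
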